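import Literature.NumberTheory.Automorphic.Liu2021.Def411WeilCarriersAtChiSplittingGluing
import Literature.NumberTheory.Automorphic.Liu2021.Def411WeilCarriersSphericalLineOfFirstSentence
import Literature.NumberTheory.Automorphic.Liu2021.LemD1Item1FirstSentenceAtV2OfNonsplit
import Literature.NumberTheory.GelbartRogawski1991.UndoubledSplittingsUnitary
import HarnessLib

/-!
# [Liu2021, Def. 4.11 ∕ Lem. D.1 (4)] for THE CM `θ`-packages: member-wise isomorphic local factors ⇒ isomorphic carriers — with NO letter
# (the first sentence of Lemma D.1 is in-house at every place, so the a.e. line clause is unconditional)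

Topic `NumberTheory/Automorphic/Liu2021`; namespace `Literature.NumberTheory.Automorphic.Liu2021.Def411WeilCarriers`.  Sequel of ★
`Def411WeilCarriersAtChiSplittingGluing.lean` (p830194) and ★ `Def411WeilCarriersSphericalLineOfFirstSentence.lean`.  THEOREMS ONLY: no
definition, no named fact, no instance, no `sorry`; nothing of [Liu2021] is asserted and NO per-place hypothesis remains.

The FIRST SENTENCE of [Liu2021, Lemma D.1] («`ω(μ, ε, χ)` is irreducible [or zero] and admissible») holds IN THE TREE at every finite place for the
rank-`≥ 2` datum of the CM `θ`-package `𝓢_θ(a) := congrW … (undoubledSplittings … θ 𝔪 (cmFinLocalFamily … θ hθ 𝔪)) …`: at a NON-SPLIT place by ★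
`isIrreducibleOrZero_and_isAdmissible_localLemD1DataAtV₂_of_isField` (B-typ04 (g18), over the PROVED [MoeglinVignerasWaldspurger1987, IV.4] facts), at a
SPLIT place by ★ `lemD1_1AsPrinted_localLemD1DataAtV₂_of_not_isField` `.1` (B-p04 (g30)) under the unitarity `hL2`, discharged by ★
`GRConstruction.isL2Isometric_omegaLoc_congrW_undoubledSplittings_cmFinLocalFamily` with the Borel σ-algebra and `Measure.addHaar` on `L⁺_v`.  Hence:

* **`firstSentence_localLemD1DataAtV₂_cmFinLocalFamily`** — `IsIrreducibleOrZero (‹CM datum› v).datum.quot ∧ (‹CM datum› v).datum.quot.IsAdmissible` at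
  EVERY finite place `v`, every rank `n ≥ 2`, Step 2's `μ_v` the caller's — hypothesis-free;
* **`exists_equiv_rhoVAtLine_of_forall_areIsomorphicRep_localFactor_cm`** — for two `θ`-packages over one `(L, e₁, dV₁)` with the SECOND the CM package
  `(θ₂, a₂, χ₂, 𝔪₂, cmFinLocalFamily …)`: member-wise isomorphic local factors at every place ⇒
  `∃ Ψ : ω(λ₁,ε_{a₁},χ₁)|_{⟨a₁⟩} ≃ₗ ω(λ₂,ε_{a₂},χ₂)|_{⟨a₂⟩}` intertwining `rhoVAtLine` — ★ `…_of_forall_areIsomorphicRep_localFactor` (p830194) with its line clause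
  discharged by ★ `eventually_finrank_fixedPoints_localFactor_eq_one_of_firstSentence` at the first sentence above (Step 2's `μ_v := localMu L θ₂ v`,
  ★ `norm_localMu` ∕ `continuous_localMu` ∕ `localMu_toLocalRing_eq_one_iff`).  NO LETTER.

Cell `hodgecm-mathlib`, P5 (F0P5-plan (g4) 19:17:49Z «L1 ELIMINATION — GO»): the assembler's sibling
`companionRelabelTransfer₂_of_nonsplit_if_letter (h4if)` consumes the second theorem; the companion-package letter «[Liu2021, Lem. D.1 (1)]» leaves #74's
R2′ path.  HC_CM is proved only modulo the printed citations until rung 0 closes; this file proves no cell binder and books no letter.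

## References
* [Liu2021] Y. Liu, Camb. J. Math. 9 (2021) = arXiv:2102.11518: Def. 4.11 (l. 2092–2096), App. D §D.1 Steps 1–3 (l. 5217–5221), Lemma D.1 first
  sentence (l. 5227, p. 125), (4) (l. 5235).
* [Flath1979] D. Flath, PSPM 33 (1979) part 1, §2 Example 2 and the Remark following it.
* [MoeglinVignerasWaldspurger1987] C. Mœglin, M.-F. Vignéras, J.-L. Waldspurger, LNM 1291 (1987), Chap. 3 IV.4.
* [GelbartRogawski1991] S. Gelbart, J. Rogawski, Invent. Math. 105 (1991), §3.1 Prop. 3.1.1 p. 455 L1–3.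
-/

set_option autoImplicit false

noncomputable section

open scoped Matrix Kronecker TensorProduct Classical RestrictedProduct
open NumberField IsDedekindDomain Filter Set
open _root_.MeasureTheory
open Literature.NumberTheory Literature.NumberTheory.Automorphic Literature.NumberTheory.Automorphic.UnitaryGroup
open Literature.NumberTheory.Weil1964 Literature.RepresentationTheory
open Literature.RepresentationTheory.HeisenbergGroup

namespace Literature.NumberTheory.Automorphic.Liu2021.Def411WeilCarriers

open Literature.NumberTheory.GelbartRogawski1991 Literature.NumberTheory.GelbartRogawski1991.UnitaryDualPair
open Literature.NumberTheory.GelbartRogawski1991.UnitaryDualPair.WeilCoinv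
open Literature.NumberTheory.GelbartRogawski1991.UnitaryDualPair.LocalSplitting (localMu norm_localMu continuous_localMu
  localMu_toLocalRing_eq_one_iff)
open Literature.NumberTheory.GelbartRogawski1991.GRConstruction
open Literature.NumberTheory.GaloisRepresentations Literature.RepresentationTheory.HarrisKudlaSweet1996
open Literature.NumberTheory.Automorphic.Liu2021.Def411WeilCarriersDoubling

variable (L : Type) [Field L] [NumberField L] [IsCMField L] {N' n' : ℕ} (e₁ : Fin N' × Fin 1 ≃ Fin n') (dV₁ : Fin N' → L)
/- (every further binder explicit per declaration — no section `variable` carrying a hypothesis, per the gate's D-0026 readout) -/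

/-- **The FIRST SENTENCE of [Liu2021, Lem. D.1] for THE CM `θ`-package datum at EVERY finite place, hypothesis-free**: for `θ` a unitary splitting
character, any Haar data `𝔪`, line `⟨a⟩`, `χ ∈ Chi`, rank `n ≥ 2` and Step-2 characters `μ_v` (the caller's):
`IsIrreducibleOrZero (localLemD1DataAtV₂ … a 𝓢_θ(a) … χ v).datum.quot ∧ (…).datum.quot.IsAdmissible` — `by_cases IsField (L ⊗ L⁺_v)`: NON-SPLIT ★
`isIrreducibleOrZero_and_isAdmissible_localLemD1DataAtV₂_of_isField` ([MoeglinVignerasWaldspurger1987, IV.4], PROVED in the tree); SPLIT ★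
`lemD1_1AsPrinted_localLemD1DataAtV₂_of_not_isField` `.1` with the Borel σ-algebra, `Measure.addHaar` and ★ `isL2Isometric_omegaLoc_congrW_undoubledSplittings_cmFinLocalFamily`.
[cite: Liu2021, App. D Lemma D.1, first sentence (l. 5227, p. 125); proof l. 5241–5243 (p. 126)] [cite: MoeglinVignerasWaldspurger1987, Chap. 3 IV.4]
[cite: GelbartRogawski1991, §3.1 Prop. 3.1.1 p. 455 L1–3] -/
theorem firstSentence_localLemD1DataAtV₂_cmFinLocalFamily
    (hdV₁ : ∀ i, IsCMField.complexConj L (dV₁ i) = dV₁ i) (hdV₁0 : ∀ i, dV₁ i ≠ 0)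
    (θ : HeckeCharacter L) (hθu : θ.IsUnitary) (hθs : IsSplittingChar L 1 θ) (𝔪 : ∀ v, PlaceMeasure L v)
    (a : (Fp L)ˣ) (χ : Chi (Fp L) L (IsCMField.complexConj L))
    (hn : 2 ≤ n') (μ : ∀ v : HeightOneSpectrum (𝓞 (Fp L)), (LocalRing L v)ˣ →* ℂˣ) (hμn : ∀ v x, ‖((μ v x : ℂˣ) : ℂ)‖ = 1)
    (hμc : ∀ v, Continuous fun x => ((μ v x : ℂˣ) : ℂ))
    (hμF : ∀ (v : HeightOneSpectrum (𝓞 (Fp L))) (t : (v.adicCompletion (Fp L))ˣ),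
      μ v (Units.map (algebraMap (v.adicCompletion (Fp L)) (LocalRing L v)).toMonoidHom t) = 1 ↔
        ∃ x : (LocalRing L v)ˣ, (x : LocalRing L v) * conjLocal L (IsCMField.complexConj L) v x =
          algebraMap (v.adicCompletion (Fp L)) (LocalRing L v) t)
    (v : HeightOneSpectrum (𝓞 (Fp L))) :
    IsIrreducibleOrZero (localLemD1DataAtV₂ (Fp L) L (IsCMField.complexConj L) N' e₁ (Matrix.diagonal dV₁) (complexConj_imagUnit L)
      (imagUnit_ne_zero L) (imagUnit_mul_self L) (realDiagonal_isSymm L dV₁ hdV₁) (isUnit_det_realDiagonal L dV₁ hdV₁ hdV₁0)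
      (realDiagonal_map L dV₁ hdV₁).symm a
      (congrW L e₁ dV₁ hdV₁ (lineW L (TW (Fp L) a)) (complexConj_lineW L (TW (Fp L) a)) (realDiagonal_lineW L (TW (Fp L) a))
              (diagonal_lineW L (TW (Fp L) a) (JW_eq (Fp L) L a))
              (undoubledSplittings L e₁ dV₁ hdV₁ hdV₁0 (lineW L (TW (Fp L) a)) (complexConj_lineW L (TW (Fp L) a))
                (lineW_ne_zero L (TW (Fp L) a) (isUnit_det_TW (Fp L) a)) θ 𝔪
                (cmFinLocalFamily L e₁ dV₁ hdV₁ hdV₁0 (lineW L (TW (Fp L) a)) (complexConj_lineW L (TW (Fp L) a))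
                  (lineW_ne_zero L (TW (Fp L) a) (isUnit_det_TW (Fp L) a)) θ hθs 𝔪))
              (isSymm_TW (Fp L) a) (JW_eq (Fp L) L a))
      hn μ hμn hμc hμF χ v).datum.quot ∧
      (localLemD1DataAtV₂ (Fp L) L (IsCMField.complexConj L) N' e₁ (Matrix.diagonal dV₁) (complexConj_imagUnit L)
      (imagUnit_ne_zero L) (imagUnit_mul_self L) (realDiagonal_isSymm L dV₁ hdV₁) (isUnit_det_realDiagonal L dV₁ hdV₁ hdV₁0)
      (realDiagonal_map L dV₁ hdV₁).symm a
      (congrW L e₁ dV₁ hdV₁ (lineW L (TW (Fp L) a)) (complexConj_lineW L (TW (Fp L) a)) (realDiagonal_lineW L (TW (Fp L) a))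
              (diagonal_lineW L (TW (Fp L) a) (JW_eq (Fp L) L a))
              (undoubledSplittings L e₁ dV₁ hdV₁ hdV₁0 (lineW L (TW (Fp L) a)) (complexConj_lineW L (TW (Fp L) a))
                (lineW_ne_zero L (TW (Fp L) a) (isUnit_det_TW (Fp L) a)) θ 𝔪
                (cmFinLocalFamily L e₁ dV₁ hdV₁ hdV₁0 (lineW L (TW (Fp L) a)) (complexConj_lineW L (TW (Fp L) a))
                  (lineW_ne_zero L (TW (Fp L) a) (isUnit_det_TW (Fp L) a)) θ hθs 𝔪))
              (isSymm_TW (Fp L) a) (JW_eq (Fp L) L a))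
      hn μ hμn hμc hμF χ v).datum.quot.IsAdmissible := by
  by_cases hf : IsField (LocalRing L v)
  · exact isIrreducibleOrZero_and_isAdmissible_localLemD1DataAtV₂_of_isField (Fp L) L (IsCMField.complexConj L) N' e₁ (Matrix.diagonal dV₁)
      (complexConj_imagUnit L) (imagUnit_ne_zero L) (imagUnit_mul_self L) (realDiagonal_isSymm L dV₁ hdV₁)
      (isUnit_det_realDiagonal L dV₁ hdV₁ hdV₁0) (realDiagonal_map L dV₁ hdV₁).symm a _ hn μ hμn hμc hμF χ v hf
  · letI : MeasurableSpace (v.adicCompletion (Fp L)) := borel _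
    haveI : BorelSpace (v.adicCompletion (Fp L)) := ⟨rfl⟩
    exact (lemD1_1AsPrinted_localLemD1DataAtV₂_of_not_isField (Fp L) L (IsCMField.complexConj L) N' e₁ (Matrix.diagonal dV₁)
      (complexConj_imagUnit L) (imagUnit_ne_zero L) (imagUnit_mul_self L) (realDiagonal_isSymm L dV₁ hdV₁)
      (isUnit_det_realDiagonal L dV₁ hdV₁ hdV₁0) (realDiagonal_map L dV₁ hdV₁).symm a _ hn μ hμn hμc hμF χ v hf Measure.addHaar
      (isL2Isometric_omegaLoc_congrW_undoubledSplittings_cmFinLocalFamily L e₁ dV₁ hdV₁ hdV₁0 (lineW L (TW (Fp L) a))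
        (complexConj_lineW L (TW (Fp L) a)) (lineW_ne_zero L (TW (Fp L) a) (isUnit_det_TW (Fp L) a)) θ hθs 𝔪 v hθu
        (realDiagonal_lineW L (TW (Fp L) a)) (diagonal_lineW L (TW (Fp L) a) (JW_eq (Fp L) L a)) (isSymm_TW (Fp L) a)
        (JW_eq (Fp L) L a) Measure.addHaar)).1

set_option maxHeartbeats 400000 in -- measured class (200 k, 400 k] expected: the two members' carriers and local factors displayed (as ★ p830194)
/-- **[Liu2021, Def. 4.11 ∕ Lem. D.1 (4)], THE CM `θ`-packages, NO LETTER: member-wise isomorphic local factors at every finite place ⇒ isomorphic carriers.**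
Two `θ`-packages over ONE hermitian space `(L^{N'}, diag dV₁)`, `n ≥ 2`: member 1 `(θ₁, a₁, χ₁, 𝔪₁, 𝓕₁)` arbitrary, member 2 the CM package
`(θ₂, a₂, χ₂, 𝔪₂, cmFinLocalFamily … θ₂ hθs₂ 𝔪₂)`; IF `Θ_v(1) ∘ localLineInl v ≅ Θ_v(2) ∘ localLineInl v` (★ `AreIsomorphicRep`) at EVERY finite `v`, THEN
`∃ Ψ : omegaAtLine₁ ≃ₗ[ℂ] omegaAtLine₂` intertwining `rhoVAtLine₁`, `rhoVAtLine₂` on `U(diag dV₁)(𝔸_{L⁺,f})`.  = ★ `exists_equiv_rhoVAtLine_of_forall_areIsomorphicRep_localFactor`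
with `hline` := ★ `eventually_finrank_fixedPoints_localFactor_eq_one_of_firstSentence` at `firstSentence_localLemD1DataAtV₂_cmFinLocalFamily` (Step 2's
`μ_v := localMu L θ₂ v`).  The UNCONDITIONAL form of the `⊗'` assembly of [Liu2021, Lemma D.1 (4)] for the P5 residual R2′.
[cite: Liu2021, Def. 4.11 (l. 2092–2096), App. D §D.1 Steps 1–3 (l. 5217–5221), Lemma D.1 first sentence (l. 5227), (4) (l. 5235)]
[cite: Flath1979, §2 Example 2 and Remark] -/
theorem exists_equiv_rhoVAtLine_of_forall_areIsomorphicRep_localFactor_cm [NeZero n']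
    (hdV₁ : ∀ i, IsCMField.complexConj L (dV₁ i) = dV₁ i) (hdV₁0 : ∀ i, dV₁ i ≠ 0) (hn : 2 ≤ n')
    -- member 1 (arbitrary package)
    (θ₁ : HeckeCharacter L) (hθu₁ : θ₁.IsUnitary) (hθs₁ : IsSplittingChar L 1 θ₁)
    (a₁ : (Fp L)ˣ) (χ₁ : Chi (Fp L) L (IsCMField.complexConj L)) (𝔪₁ : ∀ v, PlaceMeasure L v)
    (𝓕₁ : FinLocalFamily L e₁ dV₁ hdV₁ hdV₁0 (lineW L (TW (Fp L) a₁)) (complexConj_lineW L (TW (Fp L) a₁))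
      (lineW_ne_zero L (TW (Fp L) a₁) (isUnit_det_TW (Fp L) a₁)) θ₁ 𝔪₁)
    -- member 2 (the CM package)
    (θ₂ : HeckeCharacter L) (hθu₂ : θ₂.IsUnitary) (hθs₂ : IsSplittingChar L 1 θ₂)
    (a₂ : (Fp L)ˣ) (χ₂ : Chi (Fp L) L (IsCMField.complexConj L)) (𝔪₂ : ∀ v, PlaceMeasure L v)
    (hiso : ∀ v : HeightOneSpectrum (𝓞 (Fp L)), AreIsomorphicRep
        (show Representation ℂ (localPi L (IsCMField.complexConj L) N' (Matrix.diagonal dV₁) v) _ from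
          (TwistedCoinv.rep (localCharOfCenter (Fp L) L (IsCMField.complexConj L) (JW (Fp L) L a₁)
            (JW_apply_ne_zero (Fp L) L a₁) χ₁.1 v) ((congrW L e₁ dV₁ hdV₁ (lineW L (TW (Fp L) a₁)) (complexConj_lineW L (TW (Fp L) a₁)) (realDiagonal_lineW L (TW (Fp L) a₁))
              (diagonal_lineW L (TW (Fp L) a₁) (JW_eq (Fp L) L a₁))
              (undoubledSplittings L e₁ dV₁ hdV₁ hdV₁0 (lineW L (TW (Fp L) a₁)) (complexConj_lineW L (TW (Fp L) a₁))
                (lineW_ne_zero L (TW (Fp L) a₁) (isUnit_det_TW (Fp L) a₁)) θ₁ 𝔪₁ 𝓕₁)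
              (isSymm_TW (Fp L) a₁) (JW_eq (Fp L) L a₁)).omegaLoc v)
          (commute_omegaLoc_localCenter (Fp L) L (IsCMField.complexConj L) N' e₁ (Matrix.diagonal dV₁) (JW (Fp L) L a₁)
            (complexConj_imagUnit L) (imagUnit_ne_zero L) (imagUnit_mul_self L) (realDiagonal_isSymm L dV₁ hdV₁)
            (isSymm_TW (Fp L) a₁) (realDiagonal_map L dV₁ hdV₁).symm (JW_eq (Fp L) L a₁) (JW_apply_ne_zero (Fp L) L a₁) (congrW L e₁ dV₁ hdV₁ (lineW L (TW (Fp L) a₁)) (complexConj_lineW L (TW (Fp L) a₁)) (realDiagonal_lineW L (TW (Fp L) a₁))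
              (diagonal_lineW L (TW (Fp L) a₁) (JW_eq (Fp L) L a₁))
              (undoubledSplittings L e₁ dV₁ hdV₁ hdV₁0 (lineW L (TW (Fp L) a₁)) (complexConj_lineW L (TW (Fp L) a₁))
                (lineW_ne_zero L (TW (Fp L) a₁) (isUnit_det_TW (Fp L) a₁)) θ₁ 𝔪₁ 𝓕₁)
              (isSymm_TW (Fp L) a₁) (JW_eq (Fp L) L a₁)) v)).comp
            (localLineInl L (IsCMField.complexConj L) N' e₁ (Matrix.diagonal dV₁) (JW (Fp L) L a₁) v))
        (show Representation ℂ (localPi L (IsCMField.complexConj L) N' (Matrix.diagonal dV₁) v) _ from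
          (TwistedCoinv.rep (localCharOfCenter (Fp L) L (IsCMField.complexConj L) (JW (Fp L) L a₂)
            (JW_apply_ne_zero (Fp L) L a₂) χ₂.1 v) ((congrW L e₁ dV₁ hdV₁ (lineW L (TW (Fp L) a₂)) (complexConj_lineW L (TW (Fp L) a₂)) (realDiagonal_lineW L (TW (Fp L) a₂))
              (diagonal_lineW L (TW (Fp L) a₂) (JW_eq (Fp L) L a₂))
              (undoubledSplittings L e₁ dV₁ hdV₁ hdV₁0 (lineW L (TW (Fp L) a₂)) (complexConj_lineW L (TW (Fp L) a₂))
                (lineW_ne_zero L (TW (Fp L) a₂) (isUnit_det_TW (Fp L) a₂)) θ₂ 𝔪₂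
                (cmFinLocalFamily L e₁ dV₁ hdV₁ hdV₁0 (lineW L (TW (Fp L) a₂)) (complexConj_lineW L (TW (Fp L) a₂))
                  (lineW_ne_zero L (TW (Fp L) a₂) (isUnit_det_TW (Fp L) a₂)) θ₂ hθs₂ 𝔪₂))
              (isSymm_TW (Fp L) a₂) (JW_eq (Fp L) L a₂)).omegaLoc v)
          (commute_omegaLoc_localCenter (Fp L) L (IsCMField.complexConj L) N' e₁ (Matrix.diagonal dV₁) (JW (Fp L) L a₂)
            (complexConj_imagUnit L) (imagUnit_ne_zero L) (imagUnit_mul_self L) (realDiagonal_isSymm L dV₁ hdV₁)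
            (isSymm_TW (Fp L) a₂) (realDiagonal_map L dV₁ hdV₁).symm (JW_eq (Fp L) L a₂) (JW_apply_ne_zero (Fp L) L a₂) (congrW L e₁ dV₁ hdV₁ (lineW L (TW (Fp L) a₂)) (complexConj_lineW L (TW (Fp L) a₂)) (realDiagonal_lineW L (TW (Fp L) a₂))
              (diagonal_lineW L (TW (Fp L) a₂) (JW_eq (Fp L) L a₂))
              (undoubledSplittings L e₁ dV₁ hdV₁ hdV₁0 (lineW L (TW (Fp L) a₂)) (complexConj_lineW L (TW (Fp L) a₂))
                (lineW_ne_zero L (TW (Fp L) a₂) (isUnit_det_TW (Fp L) a₂)) θ₂ 𝔪₂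
                (cmFinLocalFamily L e₁ dV₁ hdV₁ hdV₁0 (lineW L (TW (Fp L) a₂)) (complexConj_lineW L (TW (Fp L) a₂))
                  (lineW_ne_zero L (TW (Fp L) a₂) (isUnit_det_TW (Fp L) a₂)) θ₂ hθs₂ 𝔪₂))
              (isSymm_TW (Fp L) a₂) (JW_eq (Fp L) L a₂)) v)).comp
            (localLineInl L (IsCMField.complexConj L) N' e₁ (Matrix.diagonal dV₁) (JW (Fp L) L a₂) v))) :
    ∃ Ψ : omegaAtLine (Fp L) L (IsCMField.complexConj L) N' e₁ (Matrix.diagonal dV₁) (complexConj_imagUnit L)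
          (imagUnit_ne_zero L) (imagUnit_mul_self L) (realDiagonal_isSymm L dV₁ hdV₁) (isUnit_det_realDiagonal L dV₁ hdV₁ hdV₁0)
          (realDiagonal_map L dV₁ hdV₁).symm
          (fun b => isCompatible_chiSplittingLine L e₁ dV₁ hdV₁ hdV₁0 θ₁ hθu₁ hθs₁ (TW (Fp L) b) (isSymm_TW (Fp L) b)
            (isUnit_det_TW (Fp L) b) (JW (Fp L) L b) (JW_eq (Fp L) L b)) a₁ χ₁ ≃ₗ[ℂ]
        omegaAtLine (Fp L) L (IsCMField.complexConj L) N' e₁ (Matrix.diagonal dV₁) (complexConj_imagUnit L)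
          (imagUnit_ne_zero L) (imagUnit_mul_self L) (realDiagonal_isSymm L dV₁ hdV₁) (isUnit_det_realDiagonal L dV₁ hdV₁ hdV₁0)
          (realDiagonal_map L dV₁ hdV₁).symm
          (fun b => isCompatible_chiSplittingLine L e₁ dV₁ hdV₁ hdV₁0 θ₂ hθu₂ hθs₂ (TW (Fp L) b) (isSymm_TW (Fp L) b)
            (isUnit_det_TW (Fp L) b) (JW (Fp L) L b) (JW_eq (Fp L) L b)) a₂ χ₂,
      ∀ (k : UnitaryGroup.finAdelic (Fp L) L (IsCMField.complexConj L) N' (Matrix.diagonal dV₁)) x,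
        Ψ (rhoVAtLine (Fp L) L (IsCMField.complexConj L) N' e₁ (Matrix.diagonal dV₁) (complexConj_imagUnit L)
            (imagUnit_ne_zero L) (imagUnit_mul_self L) (realDiagonal_isSymm L dV₁ hdV₁) (isUnit_det_realDiagonal L dV₁ hdV₁ hdV₁0)
            (realDiagonal_map L dV₁ hdV₁).symm
            (fun b => isCompatible_chiSplittingLine L e₁ dV₁ hdV₁ hdV₁0 θ₁ hθu₁ hθs₁ (TW (Fp L) b) (isSymm_TW (Fp L) b)
              (isUnit_det_TW (Fp L) b) (JW (Fp L) L b) (JW_eq (Fp L) L b)) a₁ χ₁ k x) =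
          rhoVAtLine (Fp L) L (IsCMField.complexConj L) N' e₁ (Matrix.diagonal dV₁) (complexConj_imagUnit L)
            (imagUnit_ne_zero L) (imagUnit_mul_self L) (realDiagonal_isSymm L dV₁ hdV₁) (isUnit_det_realDiagonal L dV₁ hdV₁ hdV₁0)
            (realDiagonal_map L dV₁ hdV₁).symm
            (fun b => isCompatible_chiSplittingLine L e₁ dV₁ hdV₁ hdV₁0 θ₂ hθu₂ hθs₂ (TW (Fp L) b) (isSymm_TW (Fp L) b)
              (isUnit_det_TW (Fp L) b) (JW (Fp L) L b) (JW_eq (Fp L) L b)) a₂ χ₂ k (Ψ x) :=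
  exists_equiv_rhoVAtLine_of_forall_areIsomorphicRep_localFactor L e₁ dV₁ hdV₁ hdV₁0 θ₁ hθu₁ hθs₁ a₁ χ₁ 𝔪₁ 𝓕₁ θ₂ hθu₂ hθs₂ a₂ χ₂ 𝔪₂
    (cmFinLocalFamily L e₁ dV₁ hdV₁ hdV₁0 (lineW L (TW (Fp L) a₂)) (complexConj_lineW L (TW (Fp L) a₂))
                  (lineW_ne_zero L (TW (Fp L) a₂) (isUnit_det_TW (Fp L) a₂)) θ₂ hθs₂ 𝔪₂)
    hiso
    (eventually_finrank_fixedPoints_localFactor_eq_one_of_firstSentence (Fp L) L (IsCMField.complexConj L) N' e₁ (Matrix.diagonal dV₁)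
      (complexConj_imagUnit L) (imagUnit_ne_zero L) (imagUnit_mul_self L) (realDiagonal_isSymm L dV₁ hdV₁)
      (isUnit_det_realDiagonal L dV₁ hdV₁ hdV₁0) (realDiagonal_map L dV₁ hdV₁).symm a₂
      (congrW L e₁ dV₁ hdV₁ (lineW L (TW (Fp L) a₂)) (complexConj_lineW L (TW (Fp L) a₂)) (realDiagonal_lineW L (TW (Fp L) a₂))
              (diagonal_lineW L (TW (Fp L) a₂) (JW_eq (Fp L) L a₂))
              (undoubledSplittings L e₁ dV₁ hdV₁ hdV₁0 (lineW L (TW (Fp L) a₂)) (complexConj_lineW L (TW (Fp L) a₂))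
                (lineW_ne_zero L (TW (Fp L) a₂) (isUnit_det_TW (Fp L) a₂)) θ₂ 𝔪₂
                (cmFinLocalFamily L e₁ dV₁ hdV₁ hdV₁0 (lineW L (TW (Fp L) a₂)) (complexConj_lineW L (TW (Fp L) a₂))
                  (lineW_ne_zero L (TW (Fp L) a₂) (isUnit_det_TW (Fp L) a₂)) θ₂ hθs₂ 𝔪₂))
              (isSymm_TW (Fp L) a₂) (JW_eq (Fp L) L a₂)) hn (localMu L θ₂) (fun v x => norm_localMu L θ₂ v hθu₂ x) (fun v => continuous_localMu L θ₂ v)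
      (fun v t => localMu_toLocalRing_eq_one_iff L θ₂ v hθs₂ t) χ₂
      (firstSentence_localLemD1DataAtV₂_cmFinLocalFamily L e₁ dV₁ hdV₁ hdV₁0 θ₂ hθu₂ hθs₂ 𝔪₂ a₂ χ₂ hn (localMu L θ₂)
        (fun v x => norm_localMu L θ₂ v hθu₂ x) (fun v => continuous_localMu L θ₂ v)
        (fun v t => localMu_toLocalRing_eq_one_iff L θ₂ v hθs₂ t)))

end Literature.NumberTheory.Automorphic.Liu2021.Def411WeilCarriers

end
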